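import Literature.NumberTheory.DiophantineGeometry.AbcWave0
import HarnessLib

/-!
# `abc ⟹ Szpiro`: the arithmetic core (Silverman, AEC VIII.11.5(b) and Exercise 8.21)

Trunk `DiophValNum` / family `abc` (companion proof file of
`Literature.NumberTheory.EllipticCurves.Szpiro`; theorems only, no definitions).

This file isolates the part of the proof of "the abc conjecture implies Szpiro's conjecture"
(Silverman, *The Arithmetic of Elliptic Curves*, 2nd ed. 2009, Prop. VIII.11.5(b), PDF pp. 223–224, with
the general case `gcd(c₄³, c₆²) > 1` of Exercise 8.21, PDF p. 230) that is pure arithmetic of the integers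
`c₄, c₆, Δ` of a minimal Weierstrass equation and of the conductor `N`, once the elliptic-curve input has
been reduced to the following hypotheses on natural numbers `m = |c₄|`, `n = |c₆|`, `d = |Δ|`, `N = N_E`:

* the relation `c₄³ − c₆² = 1728 Δ` (one of `m³ + n² = 1728 d`, `m³ + 1728 d = n²`,
  `n² + 1728 d = m³` according to signs);
* `H1`: every prime dividing `d` divides `N` (bad primes divide the conductor);
* `H2`: a prime `p ≥ 5` dividing `d` and `m` has `p² ∣ N` (additive reduction, Ex. 8.21: "if
  `p ≥ 5` divides `G`, then `E` has additive reduction at `p`, so `p² ∣ N_E`");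
* `H3`–`H5`: the minimality constraints `¬ (p⁴ ∣ c₄ ∧ p⁶ ∣ c₆)` for `p ≥ 5`,
  `¬ (2⁸ ∣ c₄ ∧ 2¹¹ ∣ c₆)`, `¬ (3⁵ ∣ c₄ ∧ 3⁹ ∣ c₆)` (Ex. 8.21: "use the minimality of the equation
  to bound the powers of the primes `p` dividing `G`").

Following the hint of Exercise 8.21 we put `G = gcd(c₄³, c₆²)` and apply the abc conjecture (in the
`≤`-form over `Literature.NumberTheory.DiophantineGeometry.IsABCTriple` / `Literature.NumberTheory.DiophantineGeometry.rad`, the antecedent of `Literature.NumberTheory.EllipticCurves.szpiro_of_abcLe`) to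
the primitive triple `(c₄³/G, c₆²/G, 1728Δ/G)`. Writing `s` for the set of primes of `6 d`, `m_s, n_s`
for the `s`-parts of `m, n` and `P` for the product of the primes of `m n` outside `s`, the estimates are
`rad ≤ 6 · P · rad(d)` (`radical_le`), `G ≤ 72 · m_s · n_s · ∏_{p ≥ 5, p ∣ d, p ∣ m} p` (`gcd_le`, from
the local inequality `min(3a, 2b) ≤ a + b + 1`), `(m_s n_s P)⁶ ≤ max(m³, n²)⁵` and
`rad(d) · ∏_{p ≥ 5, p ∣ d, p ∣ m} p ∣ N` (`radical_mul_prod_dvd`); the resulting inequality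
`M ≤ 432 · 6^ε K · M^{5(1+ε)/6} N^{1+ε}` for `M = max(m³, n²)` is solved in `real_step`, giving
`M ≤ C · N^{6(1+ε)/(1−5ε)}` — Silverman's "`|Δ|^{1−5ε} ≤ κ_ε^6 N_E^{6+6ε}`, which is Szpiro's
conjecture up to adjusting the `ε`" (PDF p. 224). The degenerate cases `c₄ = 0` or `c₆ = 0` are treated
directly (`le_pow_five`). The final statement is `Literature.NumberTheory.EllipticCurves.SzpiroOfAbc.natAbs_le_of_abcLe`.

## References

* J. H. Silverman, *The Arithmetic of Elliptic Curves*, GTM 106, 2nd ed., Springer 2009, §VIII.11,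
  Prop. 11.5(b) (PDF pp. 223–224) and Exercise 8.21 (PDF p. 230). [SilvermanAEC2009]
-/

open UniqueFactorizationMonoid Finset

namespace Literature.NumberTheory.EllipticCurves.SzpiroOfAbc

/-! ### The abc conjecture applied to a non-primitive triple -/

/-- The abc conjecture (`≤`-form, exponent `1 + ε`, constant `K`) for a not necessarily coprime sum
`a + b = c` of positive naturals: the bound acquires the factor `gcd(a, b)` (divide by the gcd and
use `rad(a'b'c') ∣ rad(abc)`). Silverman AEC VIII.11.4 and Ex. 8.21 (the triple divided by `G`).
[cite: SilvermanAEC2009, VIII.11.4 and Ex. 8.21] -/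
theorem abc_of_add_eq {ε K : ℝ} (hε : 0 < ε)
    (hK : ∀ a b c : ℕ, DiophantineGeometry.IsABCTriple a b c → (c : ℝ) ≤ K * ((DiophantineGeometry.rad a b c : ℕ) : ℝ) ^ (1 + ε))
    {a b c : ℕ} (ha : 0 < a) (hb : 0 < b) (habc : a + b = c) :
    (c : ℝ) ≤ Nat.gcd a b * K * ((radical (a * b * c) : ℕ) : ℝ) ^ (1 + ε) := by
  set g := Nat.gcd a b with hg
  have hg0 : 0 < g := Nat.gcd_pos_of_pos_left b ha
  obtain ⟨a', ha'⟩ : g ∣ a := Nat.gcd_dvd_left a b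
  obtain ⟨b', hb'⟩ : g ∣ b := Nat.gcd_dvd_right a b
  have hc' : c = g * (a' + b') := by rw [← habc, ha', hb']; ring
  have ha'0 : 0 < a' := Nat.pos_of_mul_pos_left (ha' ▸ ha)
  have hb'0 : 0 < b' := Nat.pos_of_mul_pos_left (hb' ▸ hb)
  have hcop : Nat.Coprime a' b' := by
    have := Nat.coprime_div_gcd_div_gcd (m := a) (n := b) hg0
    rwa [← hg, ha', hb', Nat.mul_div_cancel_left _ hg0, Nat.mul_div_cancel_left _ hg0] at this
  have h1 := hK a' b' (a' + b') ⟨ha'0, hb'0, rfl, hcop⟩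
  have hc0 : c ≠ 0 := by omega
  have habc0 : a * b * c ≠ 0 := by positivity
  have hdvd : a' * b' * (a' + b') ∣ a * b * c := ⟨g ^ 3, by rw [ha', hb', hc']; ring⟩
  have hrad : (DiophantineGeometry.rad a' b' (a' + b') : ℕ) ≤ radical (a * b * c) :=
    Nat.le_of_dvd (Nat.radical_pos _) (radical_dvd_radical hdvd habc0)
  have hr0 : (0 : ℝ) < ((DiophantineGeometry.rad a' b' (a' + b') : ℕ) : ℝ) := by exact_mod_cast Nat.radical_pos _
  have hKpos : 0 < K := by
    have h2 : (0 : ℝ) < ((a' + b' : ℕ) : ℝ) := by exact_mod_cast Nat.add_pos_left ha'0 b'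
    exact pos_of_mul_pos_left (h2.trans_le h1) (Real.rpow_nonneg hr0.le _)
  have h4 : K * ((DiophantineGeometry.rad a' b' (a' + b') : ℕ) : ℝ) ^ (1 + ε) ≤
      K * ((radical (a * b * c) : ℕ) : ℝ) ^ (1 + ε) :=
    mul_le_mul_of_nonneg_left (Real.rpow_le_rpow hr0.le (by exact_mod_cast hrad) (by linarith))
      hKpos.le
  have h5 : ((a' + b' : ℕ) : ℝ) ≤ K * ((radical (a * b * c) : ℕ) : ℝ) ^ (1 + ε) := h1.trans h4
  have hg0' : (0 : ℝ) ≤ (g : ℝ) := by positivity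
  calc (c : ℝ) = (g : ℝ) * ((a' + b' : ℕ) : ℝ) := by rw [hc']; push_cast; ring
    _ ≤ (g : ℝ) * (K * ((radical (a * b * c) : ℕ) : ℝ) ^ (1 + ε)) :=
        mul_le_mul_of_nonneg_left h5 hg0'
    _ = _ := by ring

/-- The three sign arrangements of `c₄³ − c₆² = 1728 Δ` among `X = |c₄|³`, `Y = c₆²`, `Z = 1728 |Δ|`:
in each case `max(X, Y) ≤ gcd(X, Y) · K · rad(X Y Z)^{1+ε}` (the gcd of the two summands is always
`gcd(X, Y)`). Silverman AEC VIII.11.5(b), Ex. 8.21. [cite: SilvermanAEC2009, VIII.11.5(b) and Ex. 8.21] -/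
theorem abc_max_le {ε K : ℝ} (hε : 0 < ε)
    (hK : ∀ a b c : ℕ, DiophantineGeometry.IsABCTriple a b c → (c : ℝ) ≤ K * ((DiophantineGeometry.rad a b c : ℕ) : ℝ) ^ (1 + ε))
    {X Y Z : ℕ} (hX : 0 < X) (hY : 0 < Y) (hZ : 0 < Z)
    (h : X + Y = Z ∨ X + Z = Y ∨ Y + Z = X) :
    ((max X Y : ℕ) : ℝ) ≤ Nat.gcd X Y * K * ((radical (X * Y * Z) : ℕ) : ℝ) ^ (1 + ε) := by
  rcases h with h | h | h
  · have := abc_of_add_eq hε hK hX hY h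
    have hm : max X Y ≤ Z := by omega
    calc ((max X Y : ℕ) : ℝ) ≤ Z := by exact_mod_cast hm
      _ ≤ _ := this
  · have := abc_of_add_eq hε hK hX hZ h
    have hm : max X Y = Y := by omega
    have hg : Nat.gcd X Z = Nat.gcd X Y := by
      rw [← h, Nat.gcd_self_add_right]
    have hr : X * Z * Y = X * Y * Z := by ring
    rw [hm, ← hg, ← hr]
    exact this
  · have := abc_of_add_eq hε hK hY hZ h
    have hm : max X Y = X := by omega
    have hg : Nat.gcd Y Z = Nat.gcd X Y := by
      rw [← h, Nat.gcd_comm (Y + Z) Y, Nat.gcd_self_add_right]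
    have hr : Y * Z * X = X * Y * Z := by ring
    rw [hm, ← hg, ← hr]
    exact this

/-! ### The real-analytic step -/

/-- Solving `M ≤ 432 · 6^ε K · M^{5(1+ε)/6} · N^{1+ε}` for `M`: if `M ≤ G K T^{1+ε}`,
`T ≤ 6 P R`, `G ≤ 72 B R₂`, `(B P)⁶ ≤ M⁵` and `R R₂ ≤ N`, then
`M ≤ (432 · 6^ε K)^{6/(1−5ε)} · N^{6(1+ε)/(1−5ε)}`. This is Silverman's manipulation
"`|Δ|^{1−5ε} ≤ κ_ε^6 N_E^{6+6ε}`" (AEC PDF p. 224) in the form needed here.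
[cite: SilvermanAEC2009, VIII.11.5(b), PDF p. 224] -/
theorem real_step {ε K : ℝ} (hε : 0 < ε) (hε' : ε ≤ 1 / 41) (hK : 0 < K)
    {M G T P R B R₂ N : ℕ} (hM1 : 1 ≤ M) (hB : 1 ≤ B) (hR₂ : 1 ≤ R₂) (hP : 1 ≤ P) (hN : 1 ≤ N)
    (hM : (M : ℝ) ≤ G * K * (T : ℝ) ^ (1 + ε))
    (hT : T ≤ 6 * P * R) (hG : G ≤ 72 * B * R₂) (hQ : (B * P) ^ 6 ≤ M ^ 5) (hL : R * R₂ ≤ N) :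
    (M : ℝ) ≤ (432 * (6 : ℝ) ^ ε * K) ^ (6 / (1 - 5 * ε)) *
      (N : ℝ) ^ (6 * (1 + ε) / (1 - 5 * ε)) := by
  have hε1 : 0 ≤ 1 + ε := by linarith
  have hθ : 0 < 1 - 5 * ε := by linarith
  -- `T^(1+ε) ≤ 6^(1+ε) P^(1+ε) R^(1+ε)`
  have hT' : (T : ℝ) ^ (1 + ε) ≤ (6 : ℝ) ^ (1 + ε) * (P : ℝ) ^ (1 + ε) * (R : ℝ) ^ (1 + ε) := by
    have h1 : (T : ℝ) ≤ 6 * P * R := by exact_mod_cast hT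
    calc (T : ℝ) ^ (1 + ε) ≤ ((6 : ℝ) * P * R) ^ (1 + ε) :=
          Real.rpow_le_rpow (by positivity) h1 hε1
      _ = _ := by
          rw [Real.mul_rpow (by positivity) (by positivity),
            Real.mul_rpow (by positivity) (by positivity)]
  -- `G ≤ 72 B^(1+ε) R₂^(1+ε)`
  have hG' : (G : ℝ) ≤ 72 * (B : ℝ) ^ (1 + ε) * (R₂ : ℝ) ^ (1 + ε) := by
    have h1 : (G : ℝ) ≤ 72 * B * R₂ := by exact_mod_cast hG
    have hB1 : (B : ℝ) ≤ (B : ℝ) ^ (1 + ε) :=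
      Real.self_le_rpow_of_one_le (by exact_mod_cast hB) (by linarith)
    have hR1 : (R₂ : ℝ) ≤ (R₂ : ℝ) ^ (1 + ε) :=
      Real.self_le_rpow_of_one_le (by exact_mod_cast hR₂) (by linarith)
    calc (G : ℝ) ≤ 72 * B * R₂ := h1
      _ ≤ 72 * (B : ℝ) ^ (1 + ε) * (R₂ : ℝ) ^ (1 + ε) := by gcongr
  -- `(B P)^(1+ε) ≤ M^(5(1+ε)/6)` and `(R R₂)^(1+ε) ≤ N^(1+ε)`
  have hBP : (B : ℝ) ^ (1 + ε) * (P : ℝ) ^ (1 + ε) ≤ (M : ℝ) ^ (5 * (1 + ε) / 6) := by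
    have h1 : ((B * P : ℕ) : ℝ) ^ (6 : ℕ) ≤ ((M : ℝ)) ^ (5 : ℕ) := by exact_mod_cast hQ
    have h2 : ((B * P : ℕ) : ℝ) ≤ (M : ℝ) ^ ((5 : ℝ) / 6) := by
      have h3 : ((B * P : ℕ) : ℝ) = ((((B * P : ℕ) : ℝ)) ^ (6 : ℕ)) ^ ((1 : ℝ) / 6) := by
        rw [← Real.rpow_natCast, ← Real.rpow_mul (by positivity)]
        norm_num
      rw [h3]
      calc ((((B * P : ℕ) : ℝ)) ^ (6 : ℕ)) ^ ((1 : ℝ) / 6)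
          ≤ (((M : ℝ)) ^ (5 : ℕ)) ^ ((1 : ℝ) / 6) :=
            Real.rpow_le_rpow (by positivity) h1 (by norm_num)
        _ = (M : ℝ) ^ ((5 : ℝ) / 6) := by
            rw [← Real.rpow_natCast, ← Real.rpow_mul (by positivity)]
            norm_num
    calc (B : ℝ) ^ (1 + ε) * (P : ℝ) ^ (1 + ε) = ((B * P : ℕ) : ℝ) ^ (1 + ε) := by
          push_cast
          rw [Real.mul_rpow (by positivity) (by positivity)]
      _ ≤ ((M : ℝ) ^ ((5 : ℝ) / 6)) ^ (1 + ε) := Real.rpow_le_rpow (by positivity) h2 hε1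
      _ = (M : ℝ) ^ (5 * (1 + ε) / 6) := by
          rw [← Real.rpow_mul (by positivity)]
          ring_nf
  have hRR : (R : ℝ) ^ (1 + ε) * (R₂ : ℝ) ^ (1 + ε) ≤ (N : ℝ) ^ (1 + ε) := by
    have h1 : ((R * R₂ : ℕ) : ℝ) ≤ N := by exact_mod_cast hL
    calc (R : ℝ) ^ (1 + ε) * (R₂ : ℝ) ^ (1 + ε) = ((R * R₂ : ℕ) : ℝ) ^ (1 + ε) := by
          push_cast
          rw [Real.mul_rpow (by positivity) (by positivity)]
      _ ≤ (N : ℝ) ^ (1 + ε) := Real.rpow_le_rpow (by positivity) h1 hε1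
  -- combine: `M ≤ A · M^(5(1+ε)/6) · N^(1+ε)` with `A = 432 · 6^ε · K`
  set A : ℝ := 432 * (6 : ℝ) ^ ε * K with hA
  have hApos : 0 < A := by positivity
  have h6 : (6 : ℝ) ^ (1 + ε) = 6 * (6 : ℝ) ^ ε := by
    rw [Real.rpow_add (by norm_num), Real.rpow_one]
  have hmain : (M : ℝ) ≤ A * (M : ℝ) ^ (5 * (1 + ε) / 6) * (N : ℝ) ^ (1 + ε) := by
    calc (M : ℝ) ≤ G * K * (T : ℝ) ^ (1 + ε) := hM
      _ ≤ (72 * (B : ℝ) ^ (1 + ε) * (R₂ : ℝ) ^ (1 + ε)) * K *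
            ((6 : ℝ) ^ (1 + ε) * (P : ℝ) ^ (1 + ε) * (R : ℝ) ^ (1 + ε)) := by gcongr
      _ = 72 * (6 : ℝ) ^ (1 + ε) * K * ((B : ℝ) ^ (1 + ε) * (P : ℝ) ^ (1 + ε)) *
            ((R : ℝ) ^ (1 + ε) * (R₂ : ℝ) ^ (1 + ε)) := by ring
      _ ≤ 72 * (6 : ℝ) ^ (1 + ε) * K * (M : ℝ) ^ (5 * (1 + ε) / 6) * (N : ℝ) ^ (1 + ε) := by
          gcongr
      _ = A * (M : ℝ) ^ (5 * (1 + ε) / 6) * (N : ℝ) ^ (1 + ε) := by rw [hA, h6]; ring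
  -- divide by `M^(5(1+ε)/6)` and take the `1/θ`-th power, `θ = (1 - 5ε)/6`
  have hMpos : (0 : ℝ) < M := by exact_mod_cast hM1
  set θ : ℝ := (1 - 5 * ε) / 6 with hθdef
  have hθpos : 0 < θ := by positivity
  have hsplit : (M : ℝ) = (M : ℝ) ^ θ * (M : ℝ) ^ (5 * (1 + ε) / 6) := by
    rw [← Real.rpow_add hMpos]
    have : θ + 5 * (1 + ε) / 6 = 1 := by rw [hθdef]; ring
    rw [this, Real.rpow_one]
  have hθle : (M : ℝ) ^ θ ≤ A * (N : ℝ) ^ (1 + ε) := by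
    have hpow : 0 < (M : ℝ) ^ (5 * (1 + ε) / 6) := Real.rpow_pos_of_pos hMpos _
    rw [hsplit] at hmain
    have : (M : ℝ) ^ θ * (M : ℝ) ^ (5 * (1 + ε) / 6) ≤
        (A * (N : ℝ) ^ (1 + ε)) * (M : ℝ) ^ (5 * (1 + ε) / 6) := by
      calc _ ≤ A * ((M : ℝ) ^ θ * (M : ℝ) ^ (5 * (1 + ε) / 6)) ^ (5 * (1 + ε) / 6) *
            (N : ℝ) ^ (1 + ε) := hmain
        _ = _ := by rw [← hsplit]; ring
    exact le_of_mul_le_mul_right this hpow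
  have hfinal : (M : ℝ) ≤ (A * (N : ℝ) ^ (1 + ε)) ^ (1 / θ) := by
    have h1 : (M : ℝ) = ((M : ℝ) ^ θ) ^ (1 / θ) := by
      rw [← Real.rpow_mul hMpos.le, mul_one_div_cancel hθpos.ne', Real.rpow_one]
    rw [h1]
    exact Real.rpow_le_rpow (by positivity) hθle (by positivity)
  calc (M : ℝ) ≤ (A * (N : ℝ) ^ (1 + ε)) ^ (1 / θ) := hfinal
    _ = A ^ (1 / θ) * ((N : ℝ) ^ (1 + ε)) ^ (1 / θ) := Real.mul_rpow hApos.le (by positivity)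
    _ = A ^ (6 / (1 - 5 * ε)) * (N : ℝ) ^ (6 * (1 + ε) / (1 - 5 * ε)) := by
        rw [← Real.rpow_mul (by positivity)]
        congr 1
        · congr 1; rw [hθdef]; field_simp
        · congr 1; rw [hθdef]; field_simp

/-! ### Prime factorisations -/

/-- `1728 = 2⁶ · 3³` has prime factors `{2, 3}`. [folklore] -/
theorem primeFactors_1728 : Nat.primeFactors 1728 = {2, 3} := by
  rw [show (1728 : ℕ) = 2 ^ 6 * 3 ^ 3 by norm_num, Nat.primeFactors_mul (by norm_num) (by norm_num),
    Nat.primeFactors_prime_pow (by norm_num) Nat.prime_two,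
    Nat.primeFactors_prime_pow (by norm_num) Nat.prime_three]
  rfl

/-- `6 = 2 · 3` has prime factors `{2, 3}`. [folklore] -/
theorem primeFactors_six : Nat.primeFactors 6 = {2, 3} := by
  rw [show (6 : ℕ) = 2 * 3  by norm_num, Nat.primeFactors_mul (by norm_num) (by norm_num),
    Nat.prime_two.primeFactors, Nat.prime_three.primeFactors]
  rfl

/-- The prime factors of `6 d` are `2, 3` and those of `d`. [folklore] -/
theorem primeFactors_six_mul {d : ℕ} (hd : d ≠ 0) :
    (6 * d).primeFactors = {2, 3} ∪ d.primeFactors := by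
  rw [Nat.primeFactors_mul (by norm_num) hd, primeFactors_six]

/-- `rad(6) = 6`. [folklore] -/
theorem radical_six : radical (6 : ℕ) = 6 := by
  rw [Nat.radical_eq_prod_primeFactors, primeFactors_six]
  rfl

/-- A prime dividing `1728 d` divides `6 d`, i.e. is a prime factor of `6 d`. [folklore] -/
theorem mem_primeFactors_of_dvd_1728_mul {p d : ℕ} (hp : p.Prime) (hd : d ≠ 0)
    (h : p ∣ 1728 * d) : p ∈ (6 * d).primeFactors := by
  refine hp.mem_primeFactors ?_ (by positivity)
  rcases hp.dvd_mul.mp h with h | h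
  · exact (hp.dvd_of_dvd_pow (n := 6) (h.trans ⟨27, by norm_num⟩)).trans (dvd_mul_right 6 d)
  · exact h.trans (dvd_mul_left d 6)

/-- Splitting `n = (s-free part) · (s-part)` of the prime factorisation of `n ≠ 0` along a finite set
of primes `s`. [folklore] -/
theorem prod_sdiff_mul_prod_inter_factorization {n : ℕ} (hn : n ≠ 0) (s : Finset ℕ) :
    (∏ p ∈ n.primeFactors \ s, p ^ n.factorization p) *
      (∏ p ∈ n.primeFactors ∩ s, p ^ n.factorization p) = n := by
  have h := Finset.prod_sdiff (s₁ := n.primeFactors ∩ s) (s₂ := n.primeFactors)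
    (f := fun p ↦ p ^ n.factorization p) Finset.inter_subset_left
  rw [Finset.sdiff_inter_self_left] at h
  rw [h]
  exact (Nat.prod_primeFactors_pow_factorization hn).symm

/-- The product of the primes of `m n` outside `s` divides the product of the `s`-free parts of `m`
and `n`. [folklore] -/
theorem prod_primeFactors_sdiff_dvd {m n : ℕ} (hm : m ≠ 0) (hn : n ≠ 0) (s : Finset ℕ) :
    (∏ p ∈ (m * n).primeFactors \ s, p) ∣
      (∏ p ∈ m.primeFactors \ s, p ^ m.factorization p) *
        (∏ p ∈ n.primeFactors \ s, p ^ n.factorization p) := by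
  rw [Nat.primeFactors_mul hm hn, Finset.union_sdiff_distrib]
  have h1 : (∏ p ∈ m.primeFactors \ s ∪ n.primeFactors \ s, p) ∣
      (∏ p ∈ m.primeFactors \ s, p) * (∏ p ∈ n.primeFactors \ s, p) := by
    rw [← Finset.prod_union_inter]
    exact Dvd.intro _ rfl
  refine h1.trans (mul_dvd_mul ?_ ?_)
  · refine Finset.prod_dvd_prod_of_dvd _ _ fun p hp ↦ dvd_pow_self p ?_
    rw [Finset.mem_sdiff] at hp
    exact Finsupp.mem_support_iff.mp hp.1
  · refine Finset.prod_dvd_prod_of_dvd _ _ fun p hp ↦ dvd_pow_self p ?_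
    rw [Finset.mem_sdiff] at hp
    exact Finsupp.mem_support_iff.mp hp.1

/-- A product of powers of distinct primes divides `N` as soon as each factor does. [folklore] -/
theorem prod_prime_pow_dvd {s : Finset ℕ} (hs : ∀ p ∈ s, p.Prime) (e : ℕ → ℕ) {N : ℕ}
    (h : ∀ p ∈ s, p ^ e p ∣ N) : ∏ p ∈ s, p ^ e p ∣ N := by
  classical
  induction s using Finset.induction_on with
  | empty => simp
  | insert a s ha ih =>
    rw [Finset.prod_insert ha]
    have hcop : Nat.Coprime (a ^ e a) (∏ p ∈ s, p ^ e p) := by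
      refine Nat.Coprime.prod_right fun p hp ↦ ?_
      refine Nat.coprime_pow_primes _ _ (hs a (Finset.mem_insert_self a s))
        (hs p (Finset.mem_insert_of_mem hp)) ?_
      rintro rfl
      exact ha hp
    exact hcop.mul_dvd_of_dvd_of_dvd (h a (Finset.mem_insert_self a s))
      (ih (fun p hp ↦ hs p (Finset.mem_insert_of_mem hp))
        (fun p hp ↦ h p (Finset.mem_insert_of_mem hp)))

/-! ### The four estimates -/

/-- `rad(m³ n² · 1728 d) ≤ 6 · P · rad(d)`, where `P` is the product of the primes of `m n` prime to
`6 d`: the refinement of "the product `∏_{p ∣ c₄ c₆ Δ} p` is smaller than `|c₄ c₆ N_E|`"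
(Silverman AEC PDF p. 224) that keeps track of the primes of `c₄ c₆` dividing `6 Δ` separately.
[cite: SilvermanAEC2009, VIII.11.5(b), PDF p. 224] -/
theorem radical_le {m n d : ℕ} (hm : m ≠ 0) (hn : n ≠ 0) (hd : d ≠ 0) :
    radical (m ^ 3 * n ^ 2 * (1728 * d)) ≤
      6 * (∏ p ∈ (m * n).primeFactors \ (6 * d).primeFactors, p) * radical d := by
  have hpf : (m ^ 3 * n ^ 2 * (1728 * d)).primeFactors =
      ((m * n).primeFactors \ (6 * d).primeFactors) ∪ (6 * d).primeFactors := by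
    rw [Finset.sdiff_union_self_eq_union, Nat.primeFactors_mul (by positivity) (by positivity),
      Nat.primeFactors_mul (by positivity) (by positivity), Nat.primeFactors_pow _ three_ne_zero,
      Nat.primeFactors_pow _ two_ne_zero, Nat.primeFactors_mul (by norm_num) hd, primeFactors_1728,
      Nat.primeFactors_mul hm hn, primeFactors_six_mul hd]
  rw [Nat.radical_eq_prod_primeFactors, hpf, Finset.prod_union Finset.sdiff_disjoint,
    ← Nat.radical_eq_prod_primeFactors]
  have h6d : radical (6 * d) ≤ 6 * radical d := by
    have := radical_mul_dvd (a := (6 : ℕ)) (b := d)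
    rw [radical_six] at this
    exact Nat.le_of_dvd (by positivity) this
  calc (∏ p ∈ (m * n).primeFactors \ (6 * d).primeFactors, p) * radical (6 * d)
      ≤ (∏ p ∈ (m * n).primeFactors \ (6 * d).primeFactors, p) * (6 * radical d) :=
        Nat.mul_le_mul_left _ h6d
    _ = _ := by ring

/-- The local exponent inequality at a prime `p ≥ 5` of a minimal equation (`¬ (p⁴ ∣ c₄ ∧ p⁶ ∣ c₆)`):
`min(3a, 2b) ≤ a + b + 1` for `a = v_p(c₄)`, `b = v_p(c₆)`. Silverman AEC Ex. 8.21 ("bound the powers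
of the primes `p` dividing `G`"). [cite: SilvermanAEC2009, Ex. 8.21] -/
theorem min_le_of_five_le {a b : ℕ} (h : ¬ (4 ≤ a ∧ 6 ≤ b)) : min (3 * a) (2 * b) ≤ a + b + 1 := by
  omega

/-- The local exponent inequality at `p = 2` (`¬ (2⁸ ∣ c₄ ∧ 2¹¹ ∣ c₆)`): `min(3a, 2b) ≤ a + b + 3`.
Silverman AEC Ex. 8.21. [cite: SilvermanAEC2009, Ex. 8.21] -/
theorem min_le_at_two {a b : ℕ} (h : ¬ (8 ≤ a ∧ 11 ≤ b)) : min (3 * a) (2 * b) ≤ a + b + 3 := by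
  omega

/-- The local exponent inequality at `p = 3` (`¬ (3⁵ ∣ c₄ ∧ 3⁹ ∣ c₆)`): `min(3a, 2b) ≤ a + b + 2`.
Silverman AEC Ex. 8.21. [cite: SilvermanAEC2009, Ex. 8.21] -/
theorem min_le_at_three {a b : ℕ} (h : ¬ (5 ≤ a ∧ 9 ≤ b)) : min (3 * a) (2 * b) ≤ a + b + 2 := by
  omega

/-- **The bound on `G = gcd(c₄³, c₆²)`** (Silverman AEC Exercise 8.21: "use the minimality of the
equation to bound the powers of the primes `p` dividing `G`"): with `m = |c₄|`, `n = |c₆|`, `d = |Δ|`,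
`G ≤ 72 · m_s · n_s · ∏_{p ≥ 5, p ∣ d, p ∣ m} p`, where `m_s`, `n_s` are the parts of `m`, `n`
supported on the primes of `6 d` (every prime of `G` divides `c₄`, `c₆`, hence `1728 Δ`).
[cite: SilvermanAEC2009, Ex. 8.21] -/
theorem gcd_le {m n d : ℕ} (hm : m ≠ 0) (hn : n ≠ 0) (hd : d ≠ 0)
    (hcommon : ∀ p, p.Prime → p ∣ m → p ∣ n → p ∈ (6 * d).primeFactors)
    (H3 : ∀ p, p.Prime → 5 ≤ p → p ^ 4 ∣ m → ¬ p ^ 6 ∣ n)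
    (H4 : 2 ^ 8 ∣ m → ¬ 2 ^ 11 ∣ n) (H5 : 3 ^ 5 ∣ m → ¬ 3 ^ 9 ∣ n) :
    Nat.gcd (m ^ 3) (n ^ 2) ≤
      72 * (∏ p ∈ m.primeFactors ∩ (6 * d).primeFactors, p ^ m.factorization p) *
        (∏ p ∈ n.primeFactors ∩ (6 * d).primeFactors, p ^ n.factorization p) *
        (∏ p ∈ d.primeFactors with (5 ≤ p ∧ p ∣ m), p) := by
  set s := (6 * d).primeFactors with hs
  set G := Nat.gcd (m ^ 3) (n ^ 2) with hG
  have hm3 : m ^ 3 ≠ 0 := pow_ne_zero _ hm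
  have hn2 : n ^ 2 ≠ 0 := pow_ne_zero _ hn
  have hG0 : G ≠ 0 := Nat.gcd_ne_zero_left hm3
  have hGfac : ∀ p, G.factorization p = min (3 * m.factorization p) (2 * n.factorization p) := by
    intro p
    rw [hG, Nat.factorization_gcd hm3 hn2, Nat.factorization_pow, Nat.factorization_pow]
    simp only [Finsupp.inf_apply, Finsupp.smul_apply, smul_eq_mul]
  -- primes of `G` divide `m` and `n`, hence lie in `s`
  have hGpf : ∀ p ∈ G.primeFactors, p.Prime ∧ p ∣ m ∧ p ∣ n ∧ p ∈ s := by
    intro p hp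
    have hp' := Nat.prime_of_mem_primeFactors hp
    have hpG : p ∣ G := Nat.dvd_of_mem_primeFactors hp
    have hpm : p ∣ m := hp'.dvd_of_dvd_pow (hpG.trans (Nat.gcd_dvd_left _ _))
    have hpn : p ∣ n := hp'.dvd_of_dvd_pow (hpG.trans (Nat.gcd_dvd_right _ _))
    exact ⟨hp', hpm, hpn, hcommon p hp' hpm hpn⟩
  -- the exponent bound
  set c : ℕ → ℕ := fun p ↦ if p = 2 then 3 else if p = 3 then 2 else 1 with hc
  have hexp : ∀ p ∈ G.primeFactors,
      G.factorization p ≤ m.factorization p + n.factorization p + c p := by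
    intro p hp
    obtain ⟨hp', hpm, hpn, -⟩ := hGpf p hp
    rw [hGfac]
    have key : ∀ k l : ℕ, (p ^ k ∣ m → ¬ p ^ l ∣ n) →
        ¬ (k ≤ m.factorization p ∧ l ≤ n.factorization p) := by
      intro k l hkl ⟨h1, h2⟩
      exact hkl ((hp'.pow_dvd_iff_le_factorization hm).mpr h1)
        ((hp'.pow_dvd_iff_le_factorization hn).mpr h2)
    by_cases h2 : p = 2
    · subst h2
      simpa [hc] using min_le_at_two (key 8 11 H4)
    by_cases h3 : p = 3
    · subst h3
      simpa [hc] using min_le_at_three (key 5 9 H5)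
    · have h5 : 5 ≤ p := hp'.five_le_of_ne_two_of_ne_three h2 h3
      simpa [hc, h2, h3] using min_le_of_five_le (key 4 6 (H3 p hp' h5))
  -- `G ≤ ∏ p^(a+b+c) = (∏ p^a) (∏ p^b) (∏ p^c)`
  have hG1 : G ≤ (∏ p ∈ G.primeFactors, p ^ m.factorization p) *
      (∏ p ∈ G.primeFactors, p ^ n.factorization p) * (∏ p ∈ G.primeFactors, p ^ c p) := by
    calc G = ∏ p ∈ G.primeFactors, p ^ G.factorization p :=
          Nat.prod_primeFactors_pow_factorization hG0
      _ ≤ ∏ p ∈ G.primeFactors, p ^ (m.factorization p + n.factorization p + c p) := by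
          refine Finset.prod_le_prod (fun p _ ↦ Nat.zero_le _) fun p hp ↦ ?_
          exact Nat.pow_le_pow_right (Nat.prime_of_mem_primeFactors hp).pos (hexp p hp)
      _ = _ := by
          rw [← Finset.prod_mul_distrib, ← Finset.prod_mul_distrib]
          refine Finset.prod_congr rfl fun p _ ↦ ?_
          rw [pow_add, pow_add]
  -- each factor is bounded
  have hsubm : G.primeFactors ⊆ m.primeFactors ∩ s := fun p hp ↦ by
    obtain ⟨hp', hpm, -, hps⟩ := hGpf p hp
    exact Finset.mem_inter.mpr ⟨hp'.mem_primeFactors hpm hm, hps⟩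
  have hsubn : G.primeFactors ⊆ n.primeFactors ∩ s := fun p hp ↦ by
    obtain ⟨hp', -, hpn, hps⟩ := hGpf p hp
    exact Finset.mem_inter.mpr ⟨hp'.mem_primeFactors hpn hn, hps⟩
  have hA : (∏ p ∈ G.primeFactors, p ^ m.factorization p) ≤
      ∏ p ∈ m.primeFactors ∩ s, p ^ m.factorization p :=
    Nat.le_of_dvd (Finset.prod_pos fun p hp ↦ pow_pos (Nat.prime_of_mem_primeFactors
      (Finset.mem_inter.mp hp).1).pos _) (Finset.prod_dvd_prod_of_subset _ _ _ hsubm)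
  have hB : (∏ p ∈ G.primeFactors, p ^ n.factorization p) ≤
      ∏ p ∈ n.primeFactors ∩ s, p ^ n.factorization p :=
    Nat.le_of_dvd (Finset.prod_pos fun p hp ↦ pow_pos (Nat.prime_of_mem_primeFactors
      (Finset.mem_inter.mp hp).1).pos _) (Finset.prod_dvd_prod_of_subset _ _ _ hsubn)
  have hC : (∏ p ∈ G.primeFactors, p ^ c p) ≤
      72 * ∏ p ∈ d.primeFactors with (5 ≤ p ∧ p ∣ m), p := by
    rw [← Finset.prod_filter_mul_prod_filter_not G.primeFactors
      (fun p ↦ p ∈ ({2, 3} : Finset ℕ))]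
    have h1 : (∏ p ∈ G.primeFactors with p ∈ ({2, 3} : Finset ℕ), p ^ c p) ∣ 72 := by
      have h72 : (72 : ℕ) = ∏ p ∈ ({2, 3} : Finset ℕ), p ^ c p := by
        rw [Finset.prod_pair (by norm_num)]
        simp [hc]
      rw [h72]
      exact Finset.prod_dvd_prod_of_subset _ _ _ (fun p hp ↦ (Finset.mem_filter.mp hp).2)
    have h2 : (∏ p ∈ G.primeFactors with p ∉ ({2, 3} : Finset ℕ), p ^ c p) ∣
        ∏ p ∈ d.primeFactors with (5 ≤ p ∧ p ∣ m), p := by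
      have heq : (∏ p ∈ G.primeFactors with p ∉ ({2, 3} : Finset ℕ), p ^ c p) =
          ∏ p ∈ G.primeFactors with p ∉ ({2, 3} : Finset ℕ), p := by
        refine Finset.prod_congr rfl fun p hp ↦ ?_
        have hp2 := (Finset.mem_filter.mp hp).2
        simp only [Finset.mem_insert, Finset.mem_singleton, not_or] at hp2
        simp [hc, hp2.1, hp2.2]
      rw [heq]
      refine Finset.prod_dvd_prod_of_subset _ _ _ fun p hp ↦ ?_
      obtain ⟨hpG, hp23⟩ := Finset.mem_filter.mp hp
      simp only [Finset.mem_insert, Finset.mem_singleton, not_or] at hp23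
      obtain ⟨hp', hpm, -, hps⟩ := hGpf p hpG
      have h5 : 5 ≤ p := hp'.five_le_of_ne_two_of_ne_three hp23.1 hp23.2
      have hpd : p ∈ d.primeFactors := by
        rw [hs, primeFactors_six_mul hd, Finset.mem_union] at hps
        rcases hps with h | h
        · simp only [Finset.mem_insert, Finset.mem_singleton] at h; omega
        · exact h
      exact Finset.mem_filter.mpr ⟨hpd, h5, hpm⟩
    have hpos : 0 < ∏ p ∈ d.primeFactors with (5 ≤ p ∧ p ∣ m), p :=
      Finset.prod_pos fun p hp ↦ (Nat.prime_of_mem_primeFactors (Finset.mem_filter.mp hp).1).pos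
    exact Nat.mul_le_mul (Nat.le_of_dvd (by norm_num) h1) (Nat.le_of_dvd hpos h2)
  calc G ≤ _ := hG1
    _ ≤ (∏ p ∈ m.primeFactors ∩ s, p ^ m.factorization p) *
        (∏ p ∈ n.primeFactors ∩ s, p ^ n.factorization p) *
        (72 * ∏ p ∈ d.primeFactors with (5 ≤ p ∧ p ∣ m), p) :=
        Nat.mul_le_mul (Nat.mul_le_mul hA hB) hC
    _ = _ := by ring

/-- `rad(d) · ∏_{p ≥ 5, p ∣ d, p ∣ c₄} p ∣ N`: the bad primes divide the conductor, and those `≥ 5` at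
which `c₄` also vanishes mod `p` (additive reduction) divide it twice (Silverman AEC Ex. 8.21: "if
`p ≥ 5` divides `G`, then `E` has additive reduction at `p`, so `p² ∣ N_E`").
[cite: SilvermanAEC2009, Ex. 8.21] -/
theorem radical_mul_prod_dvd {m d N : ℕ}
    (H1 : ∀ p, p.Prime → p ∣ d → p ∣ N)
    (H2 : ∀ p, p.Prime → 5 ≤ p → p ∣ d → p ∣ m → p ^ 2 ∣ N) :
    radical d * (∏ p ∈ d.primeFactors with (5 ≤ p ∧ p ∣ m), p) ∣ N := by
  classical
  rw [Nat.radical_eq_prod_primeFactors, Finset.prod_filter, ← Finset.prod_mul_distrib]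
  have heq : (∏ p ∈ d.primeFactors, p * (if 5 ≤ p ∧ p ∣ m then p else 1)) =
      ∏ p ∈ d.primeFactors, p ^ (if 5 ≤ p ∧ p ∣ m then 2 else 1) := by
    refine Finset.prod_congr rfl fun p _ ↦ ?_
    split_ifs <;> ring
  rw [heq]
  refine prod_prime_pow_dvd (fun p hp ↦ Nat.prime_of_mem_primeFactors hp) _ fun p hp ↦ ?_
  have hp' := Nat.prime_of_mem_primeFactors hp
  have hpd := Nat.dvd_of_mem_primeFactors hp
  split_ifs with hq
  · exact H2 p hp' hq.1 hpd hq.2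
  · rw [pow_one]; exact H1 p hp' hpd

/-- The degenerate cases `c₄ = 0` or `c₆ = 0`: a natural number `k` whose `2`- and `3`-adic
valuations are at most `a`, `b`, whose other valuations are at most `10`, and whose prime factors
`p ≥ 5` all satisfy `p² ∣ N`, is at most `2^a · 3^b · N⁵`. [folklore] -/
theorem le_pow_five {k N a b : ℕ} (hk : k ≠ 0) (hN : N ≠ 0)
    (h2 : k.factorization 2 ≤ a) (h3 : k.factorization 3 ≤ b)
    (h5 : ∀ p, p.Prime → 5 ≤ p → k.factorization p ≤ 10)
    (hN' : ∀ p, p.Prime → 5 ≤ p → p ∣ k → p ^ 2 ∣ N) : k ≤ 2 ^ a * 3 ^ b * N ^ 5 := by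
  classical
  set bnd : ℕ → ℕ := fun p ↦ if p = 2 then 2 ^ a else if p = 3 then 3 ^ b else (p ^ 2) ^ 5
    with hbnd
  have h1 : k ≤ ∏ p ∈ k.primeFactors, bnd p := by
    calc k = ∏ p ∈ k.primeFactors, p ^ k.factorization p :=
          Nat.prod_primeFactors_pow_factorization hk
      _ ≤ ∏ p ∈ k.primeFactors, bnd p := by
          refine Finset.prod_le_prod (fun p _ ↦ Nat.zero_le _) fun p hp ↦ ?_
          have hp' := Nat.prime_of_mem_primeFactors hp
          by_cases hp2 : p = 2
          · subst hp2; simpa [hbnd] using Nat.pow_le_pow_right two_pos h2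
          by_cases hp3 : p = 3
          · subst hp3; simpa [hbnd] using Nat.pow_le_pow_right three_pos h3
          · have h5' : 5 ≤ p := hp'.five_le_of_ne_two_of_ne_three hp2 hp3
            simp only [hbnd, hp2, hp3, if_false, ← pow_mul]
            exact Nat.pow_le_pow_right hp'.pos (h5 p hp' h5')
  have h2' : (∏ p ∈ k.primeFactors with p ∈ ({2, 3} : Finset ℕ), bnd p) ≤ 2 ^ a * 3 ^ b := by
    have h23 : 2 ^ a * 3 ^ b = ∏ p ∈ ({2, 3} : Finset ℕ), bnd p := by
      rw [Finset.prod_pair (by norm_num)]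
      simp [hbnd]
    rw [h23]
    exact Nat.le_of_dvd (Finset.prod_pos fun p hp ↦ by
        simp only [Finset.mem_insert, Finset.mem_singleton] at hp
        rcases hp with rfl | rfl <;> simp [hbnd])
      (Finset.prod_dvd_prod_of_subset _ _ _ (fun p hp ↦ (Finset.mem_filter.mp hp).2))
  have h3' : (∏ p ∈ k.primeFactors with p ∉ ({2, 3} : Finset ℕ), bnd p) ≤ N ^ 5 := by
    have heq : (∏ p ∈ k.primeFactors with p ∉ ({2, 3} : Finset ℕ), bnd p) =
        (∏ p ∈ k.primeFactors with p ∉ ({2, 3} : Finset ℕ), p ^ 2) ^ 5 := by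
      rw [← Finset.prod_pow]
      refine Finset.prod_congr rfl fun p hp ↦ ?_
      have hp2 := (Finset.mem_filter.mp hp).2
      simp only [Finset.mem_insert, Finset.mem_singleton, not_or] at hp2
      simp [hbnd, hp2.1, hp2.2]
    rw [heq]
    refine Nat.pow_le_pow_left (Nat.le_of_dvd (Nat.pos_of_ne_zero hN) ?_) 5
    refine prod_prime_pow_dvd (fun p hp ↦ Nat.prime_of_mem_primeFactors (Finset.mem_filter.mp hp).1)
      (fun _ ↦ 2) fun p hp ↦ ?_
    obtain ⟨hpk, hp23⟩ := Finset.mem_filter.mp hp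
    simp only [Finset.mem_insert, Finset.mem_singleton, not_or] at hp23
    have hp' := Nat.prime_of_mem_primeFactors hpk
    exact hN' p hp' (hp'.five_le_of_ne_two_of_ne_three hp23.1 hp23.2)
      (Nat.dvd_of_mem_primeFactors hpk)
  calc k ≤ ∏ p ∈ k.primeFactors, bnd p := h1
    _ = (∏ p ∈ k.primeFactors with p ∈ ({2, 3} : Finset ℕ), bnd p) *
          (∏ p ∈ k.primeFactors with p ∉ ({2, 3} : Finset ℕ), bnd p) :=
        (Finset.prod_filter_mul_prod_filter_not _ _ _).symm
    _ ≤ (2 ^ a * 3 ^ b) * N ^ 5 := Nat.mul_le_mul h2' h3'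
    _ = _ := by ring

/-! ### Assembly -/

/-- The abc constant is positive (apply the hypothesis to `1 + 1 = 2`). [folklore] -/
theorem abc_const_pos {ε K : ℝ}
    (hK : ∀ a b c : ℕ, DiophantineGeometry.IsABCTriple a b c → (c : ℝ) ≤ K * ((DiophantineGeometry.rad a b c : ℕ) : ℝ) ^ (1 + ε)) :
    0 < K := by
  have h := hK 1 1 2 ⟨one_pos, one_pos, rfl, Nat.coprime_one_left 1⟩
  have hr : (0 : ℝ) < ((DiophantineGeometry.rad 1 1 2 : ℕ) : ℝ) := by exact_mod_cast Nat.radical_pos _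
  have h2 : (0 : ℝ) < ((2 : ℕ) : ℝ) := by norm_num
  exact pos_of_mul_pos_left (h2.trans_le h) (Real.rpow_nonneg hr.le _)

/-- **Main case `c₄ c₆ ≠ 0`** of the arithmetic core (Silverman AEC VIII.11.5(b) with Ex. 8.21), on
natural numbers `m = |c₄|`, `n = |c₆|`, `d = |Δ|`: abc applied to the triple divided by
`G = gcd(m³, n²)` (`abc_max_le`), the estimates `radical_le`, `gcd_le`, `radical_mul_prod_dvd`, and
`real_step` give `d ≤ max(m³, n²) ≤ (432 · 6^ε K)^{6/(1−5ε)} · N^{6(1+ε)/(1−5ε)}`.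
[cite: SilvermanAEC2009, VIII.11.5(b) and Ex. 8.21] -/
theorem core_main {ε K : ℝ} (hε : 0 < ε) (hε' : ε ≤ 1 / 41)
    (hK : ∀ a b c : ℕ, DiophantineGeometry.IsABCTriple a b c → (c : ℝ) ≤ K * ((DiophantineGeometry.rad a b c : ℕ) : ℝ) ^ (1 + ε))
    {m n d N : ℕ} (hm : m ≠ 0) (hn : n ≠ 0) (hd : d ≠ 0) (hN : N ≠ 0)
    (hrel : m ^ 3 + n ^ 2 = 1728 * d ∨ m ^ 3 + 1728 * d = n ^ 2 ∨ n ^ 2 + 1728 * d = m ^ 3)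
    (H1 : ∀ p, p.Prime → p ∣ d → p ∣ N)
    (H2 : ∀ p, p.Prime → 5 ≤ p → p ∣ d → p ∣ m → p ^ 2 ∣ N)
    (H3 : ∀ p, p.Prime → 5 ≤ p → p ^ 4 ∣ m → ¬ p ^ 6 ∣ n)
    (H4 : 2 ^ 8 ∣ m → ¬ 2 ^ 11 ∣ n) (H5 : 3 ^ 5 ∣ m → ¬ 3 ^ 9 ∣ n) :
    (d : ℝ) ≤ (432 * (6 : ℝ) ^ ε * K) ^ (6 / (1 - 5 * ε)) *
      (N : ℝ) ^ (6 * (1 + ε) / (1 - 5 * ε)) := by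
  have hKpos : 0 < K := abc_const_pos hK
  set s := (6 * d).primeFactors with hs
  have hX : 0 < m ^ 3 := by positivity
  have hY : 0 < n ^ 2 := by positivity
  have hZ : 0 < 1728 * d := by positivity
  -- a prime dividing `m` and `n` divides `1728 d`
  have hcommon : ∀ p, p.Prime → p ∣ m → p ∣ n → p ∈ s := by
    intro p hp hpm hpn
    have hpX : p ∣ m ^ 3 := hpm.trans (dvd_pow_self m three_ne_zero)
    have hpY : p ∣ n ^ 2 := hpn.trans (dvd_pow_self n two_ne_zero)
    have hpZ : p ∣ 1728 * d := by
      rcases hrel with h | h | h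
      · rw [← h]; exact dvd_add hpX hpY
      · exact (Nat.dvd_add_right hpX).mp (h ▸ hpY)
      · exact (Nat.dvd_add_right hpY).mp (h ▸ hpX)
    exact mem_primeFactors_of_dvd_1728_mul hp hd hpZ
  have habc := abc_max_le hε hK hX hY hZ hrel
  -- the data of `real_step`
  set Bm := ∏ p ∈ m.primeFactors ∩ s, p ^ m.factorization p with hBm
  set Bn := ∏ p ∈ n.primeFactors ∩ s, p ^ n.factorization p with hBn
  set Gm := ∏ p ∈ m.primeFactors \ s, p ^ m.factorization p with hGm
  set Gn := ∏ p ∈ n.primeFactors \ s, p ^ n.factorization p with hGn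
  set P := ∏ p ∈ (m * n).primeFactors \ s, p with hP
  set R₂ := ∏ p ∈ d.primeFactors with (5 ≤ p ∧ p ∣ m), p with hR₂
  have hBm0 : 0 < Bm := Finset.prod_pos fun p hp ↦
    pow_pos (Nat.prime_of_mem_primeFactors (Finset.mem_inter.mp hp).1).pos _
  have hBn0 : 0 < Bn := Finset.prod_pos fun p hp ↦
    pow_pos (Nat.prime_of_mem_primeFactors (Finset.mem_inter.mp hp).1).pos _
  have hGm0 : 0 < Gm := Finset.prod_pos fun p hp ↦
    pow_pos (Nat.prime_of_mem_primeFactors (Finset.mem_sdiff.mp hp).1).pos _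
  have hGn0 : 0 < Gn := Finset.prod_pos fun p hp ↦
    pow_pos (Nat.prime_of_mem_primeFactors (Finset.mem_sdiff.mp hp).1).pos _
  have hP0 : 0 < P := Finset.prod_pos fun p hp ↦
    (Nat.prime_of_mem_primeFactors (Finset.mem_sdiff.mp hp).1).pos
  have hR₂0 : 0 < R₂ := Finset.prod_pos fun p hp ↦
    (Nat.prime_of_mem_primeFactors (Finset.mem_filter.mp hp).1).pos
  have hmeq : Gm * Bm = m := prod_sdiff_mul_prod_inter_factorization hm s
  have hneq : Gn * Bn = n := prod_sdiff_mul_prod_inter_factorization hn s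
  have hT : radical (m ^ 3 * n ^ 2 * (1728 * d)) ≤ 6 * P * radical d := radical_le hm hn hd
  have hG : Nat.gcd (m ^ 3) (n ^ 2) ≤ 72 * (Bm * Bn) * R₂ := by
    have := gcd_le hm hn hd hcommon H3 H4 H5
    simpa only [mul_assoc] using this
  have hQ : (Bm * Bn * P) ^ 6 ≤ (max (m ^ 3) (n ^ 2)) ^ 5 := by
    have hPle : P ≤ Gm * Gn :=
      Nat.le_of_dvd (Nat.mul_pos hGm0 hGn0) (prod_primeFactors_sdiff_dvd hm hn s)
    have h1 : Bm * Bn * P ≤ m * n := by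
      calc Bm * Bn * P ≤ Bm * Bn * (Gm * Gn) := Nat.mul_le_mul_left _ hPle
        _ = (Gm * Bm) * (Gn * Bn) := by ring
        _ = m * n := by rw [hmeq, hneq]
    calc (Bm * Bn * P) ^ 6 ≤ (m * n) ^ 6 := Nat.pow_le_pow_left h1 6
      _ = (m ^ 3) ^ 2 * (n ^ 2) ^ 3 := by ring
      _ ≤ (max (m ^ 3) (n ^ 2)) ^ 2 * (max (m ^ 3) (n ^ 2)) ^ 3 :=
          Nat.mul_le_mul (Nat.pow_le_pow_left (le_max_left _ _) 2)
            (Nat.pow_le_pow_left (le_max_right _ _) 3)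
      _ = (max (m ^ 3) (n ^ 2)) ^ 5 := by ring
  have hL : radical d * R₂ ≤ N :=
    Nat.le_of_dvd (Nat.pos_of_ne_zero hN) (radical_mul_prod_dvd H1 H2)
  have hmain := real_step hε hε' hKpos (M := max (m ^ 3) (n ^ 2)) (le_max_of_le_left hX)
    (Nat.mul_pos hBm0 hBn0) hR₂0 hP0 (Nat.pos_of_ne_zero hN) habc hT hG hQ hL
  -- `d ≤ max(m³, n²)`
  have hdle : d ≤ max (m ^ 3) (n ^ 2) := by
    rcases hrel with h | h | h <;> omega
  calc (d : ℝ) ≤ ((max (m ^ 3) (n ^ 2) : ℕ) : ℝ) := by exact_mod_cast hdle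
    _ ≤ _ := hmain

/-- A prime `p ≥ 5` dividing `1728 d` divides `d`. [folklore] -/
theorem dvd_of_five_le_of_dvd_1728_mul {p d : ℕ} (hp : p.Prime) (h5 : 5 ≤ p) (hd : d ≠ 0)
    (h : p ∣ 1728 * d) : p ∣ d := by
  have := mem_primeFactors_of_dvd_1728_mul hp hd h
  rw [primeFactors_six_mul hd, Finset.mem_union, Finset.mem_insert, Finset.mem_singleton] at this
  rcases this with (h | h) | h
  · omega
  · omega
  · exact Nat.dvd_of_mem_primeFactors h

/-- Degenerate case `c₄ = 0` (not covered by the abc triple, which needs nonzero entries): then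
`c₆² = 1728 |Δ|`, minimality bounds `v_p(c₆)` (`≤ 5` for `p ≥ 5`, `≤ 10`, `≤ 8` at `2`, `3`) and every
`p ≥ 5` dividing `c₆` is additive, so `|Δ| ≤ c₆² ≤ 2²⁰ 3¹⁶ N⁵`. [folklore] -/
theorem core_m_zero {n d N : ℕ} (hd : d ≠ 0) (hN : N ≠ 0) (hrel : n ^ 2 = 1728 * d)
    (H2 : ∀ p, p.Prime → 5 ≤ p → p ∣ d → p ^ 2 ∣ N)
    (H3 : ∀ p, p.Prime → 5 ≤ p → ¬ p ^ 6 ∣ n) (H4 : ¬ 2 ^ 11 ∣ n) (H5 : ¬ 3 ^ 9 ∣ n) :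
    d ≤ 2 ^ 20 * 3 ^ 16 * N ^ 5 := by
  have hn : n ≠ 0 := by rintro rfl; simp at hrel; omega
  have hfac : ∀ p, (n ^ 2).factorization p = 2 * n.factorization p := fun p ↦ by
    rw [Nat.factorization_pow]; rfl
  have hle : n ^ 2 ≤ 2 ^ 20 * 3 ^ 16 * N ^ 5 := by
    refine le_pow_five (pow_ne_zero 2 hn) hN ?_ ?_ ?_ ?_
    · rw [hfac]
      have : ¬ 11 ≤ n.factorization 2 := fun h ↦
        H4 ((Nat.prime_two.pow_dvd_iff_le_factorization hn).mpr h)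
      omega
    · rw [hfac]
      have : ¬ 9 ≤ n.factorization 3 := fun h ↦
        H5 ((Nat.prime_three.pow_dvd_iff_le_factorization hn).mpr h)
      omega
    · intro p hp h5
      rw [hfac]
      have : ¬ 6 ≤ n.factorization p := fun h ↦
        H3 p hp h5 ((hp.pow_dvd_iff_le_factorization hn).mpr h)
      omega
    · intro p hp h5 hpn
      have hpn' : p ∣ n := hp.dvd_of_dvd_pow hpn
      refine H2 p hp h5 (dvd_of_five_le_of_dvd_1728_mul hp h5 hd ?_)
      rw [← hrel]
      exact hpn'.trans (dvd_pow_self n two_ne_zero)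
  calc d ≤ n ^ 2 := by omega
    _ ≤ _ := hle

/-- Degenerate case `c₆ = 0`: then `|c₄|³ = 1728 |Δ|`, minimality bounds `v_p(c₄)` (`≤ 3` for
`p ≥ 5`, `≤ 7`, `≤ 4` at `2`, `3`) and every `p ≥ 5` dividing `c₄` is additive, so
`|Δ| ≤ |c₄|³ ≤ 2²¹ 3¹² N⁵`. [folklore] -/
theorem core_n_zero {m d N : ℕ} (hd : d ≠ 0) (hN : N ≠ 0) (hrel : m ^ 3 = 1728 * d)
    (H2 : ∀ p, p.Prime → 5 ≤ p → p ∣ d → p ∣ m → p ^ 2 ∣ N)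
    (H3 : ∀ p, p.Prime → 5 ≤ p → ¬ p ^ 4 ∣ m) (H4 : ¬ 2 ^ 8 ∣ m) (H5 : ¬ 3 ^ 5 ∣ m) :
    d ≤ 2 ^ 21 * 3 ^ 12 * N ^ 5 := by
  have hm : m ≠ 0 := by rintro rfl; simp at hrel; omega
  have hfac : ∀ p, (m ^ 3).factorization p = 3 * m.factorization p := fun p ↦ by
    rw [Nat.factorization_pow]; rfl
  have hle : m ^ 3 ≤ 2 ^ 21 * 3 ^ 12 * N ^ 5 := by
    refine le_pow_five (pow_ne_zero 3 hm) hN ?_ ?_ ?_ ?_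
    · rw [hfac]
      have : ¬ 8 ≤ m.factorization 2 := fun h ↦
        H4 ((Nat.prime_two.pow_dvd_iff_le_factorization hm).mpr h)
      omega
    · rw [hfac]
      have : ¬ 5 ≤ m.factorization 3 := fun h ↦
        H5 ((Nat.prime_three.pow_dvd_iff_le_factorization hm).mpr h)
      omega
    · intro p hp h5
      rw [hfac]
      have : ¬ 4 ≤ m.factorization p := fun h ↦
        H3 p hp h5 ((hp.pow_dvd_iff_le_factorization hm).mpr h)
      omega
    · intro p hp h5 hpm
      have hpm' : p ∣ m := hp.dvd_of_dvd_pow hpm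
      refine H2 p hp h5 (dvd_of_five_le_of_dvd_1728_mul hp h5 hd ?_) hpm'
      rw [← hrel]
      exact hpm
  calc d ≤ m ^ 3 := by omega
    _ ≤ _ := hle

/-- Sign bookkeeping: from `x³ − y² = 1728 D` in `ℤ` to one of the three additive relations between
`|x|³`, `y²`, `1728 |D|` in `ℕ`. [folklore] -/
theorem natAbs_rel {x y D : ℤ} (h : x ^ 3 - y ^ 2 = 1728 * D) :
    x.natAbs ^ 3 + y.natAbs ^ 2 = 1728 * D.natAbs ∨
      x.natAbs ^ 3 + 1728 * D.natAbs = y.natAbs ^ 2 ∨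
      y.natAbs ^ 2 + 1728 * D.natAbs = x.natAbs ^ 3 := by
  rcases abs_choice x with hx | hx <;> rcases abs_choice D with hD | hD
  · right; right; zify; rw [sq_abs, hx, hD]; linarith
  · right; left; zify; rw [sq_abs, hx, hD]; linarith
  · left; zify; rw [sq_abs, hx, hD]
    have hx0 : x ≤ 0 := by linarith [abs_nonneg x]
    have hD0 : 0 ≤ D := by linarith [abs_nonneg D]
    have h3 : x ^ 3 ≤ 0 := Odd.pow_nonpos (by decide) hx0
    nlinarith [sq_nonneg y]
  · left; zify; rw [sq_abs, hx, hD]; linarith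

/-- **Arithmetic core of `abc ⟹ Szpiro`** (Silverman AEC VIII.11.5(b) with Exercise 8.21). Assume the
abc conjecture in the `≤`-form over `IsABCTriple`/`rad`. Then for every `ε₀ > 0` there is `C` such
that for all integers `x = c₄`, `y = c₆`, `D = Δ ≠ 0` with `x³ − y² = 1728 D` and every `N ≥ 1`
satisfying `H1` (primes of `D` divide `N`), `H2` (primes `p ≥ 5` of `D` dividing `x` have
`p² ∣ N`) and the minimality constraints `H3`–`H5`, one has `|D| ≤ C · N^{6+ε₀}`.
[cite: SilvermanAEC2009, VIII.11.5(b) and Ex. 8.21] -/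
theorem natAbs_le_of_abcLe
    (habc : ∀ ε : ℝ, 0 < ε → ∃ C : ℝ, ∀ a b c : ℕ, DiophantineGeometry.IsABCTriple a b c →
      (c : ℝ) ≤ C * ((DiophantineGeometry.rad a b c : ℕ) : ℝ) ^ (1 + ε))
    (ε₀ : ℝ) (hε₀ : 0 < ε₀) :
    ∃ C : ℝ, ∀ (x y D : ℤ) (N : ℕ), D ≠ 0 → N ≠ 0 → x ^ 3 - y ^ 2 = 1728 * D →
      (∀ p : ℕ, p.Prime → (p : ℤ) ∣ D → p ∣ N) →
      (∀ p : ℕ, p.Prime → 5 ≤ p → (p : ℤ) ∣ D → (p : ℤ) ∣ x → p ^ 2 ∣ N) →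
      (∀ p : ℕ, p.Prime → 5 ≤ p → (p : ℤ) ^ 4 ∣ x → ¬ (p : ℤ) ^ 6 ∣ y) →
      ((2 : ℤ) ^ 8 ∣ x → ¬ (2 : ℤ) ^ 11 ∣ y) → ((3 : ℤ) ^ 5 ∣ x → ¬ (3 : ℤ) ^ 9 ∣ y) →
      (D.natAbs : ℝ) ≤ C * (N : ℝ) ^ (6 + ε₀) := by
  -- choice of `ε` with `6(1+ε)/(1-5ε) ≤ 6 + ε₀`
  set e : ℝ := min ε₀ 1 with he
  have he0 : 0 < e := lt_min hε₀ one_pos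
  have he1 : e ≤ 1 := min_le_right _ _
  have heε : e ≤ ε₀ := min_le_left _ _
  set ε : ℝ := e / 41 with hεdef
  have hε : 0 < ε := by positivity
  have hε' : ε ≤ 1 / 41 := by rw [hεdef]; linarith
  have hexp : 6 * (1 + ε) / (1 - 5 * ε) ≤ 6 + ε₀ := by
    rw [div_le_iff₀ (by linarith), hεdef]
    nlinarith
  obtain ⟨K, hK⟩ := habc ε hε
  have hKpos : 0 < K := abc_const_pos hK
  set A : ℝ := (432 * (6 : ℝ) ^ ε * K) ^ (6 / (1 - 5 * ε)) with hA
  have hApos : 0 < A := by positivity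
  refine ⟨A + 2 ^ 21 * 3 ^ 16, ?_⟩
  intro x y D N hD hN hrel H1 H2 H3 H4 H5
  have hN1 : (1 : ℝ) ≤ N := by exact_mod_cast Nat.one_le_iff_ne_zero.mpr hN
  have hNpow1 : (N : ℝ) ^ (6 * (1 + ε) / (1 - 5 * ε)) ≤ (N : ℝ) ^ (6 + ε₀) :=
    Real.rpow_le_rpow_of_exponent_le hN1 hexp
  have hNpow2 : ((N ^ 5 : ℕ) : ℝ) ≤ (N : ℝ) ^ (6 + ε₀) := by
    have : ((N ^ 5 : ℕ) : ℝ) = (N : ℝ) ^ ((5 : ℕ) : ℝ) := by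
      rw [Real.rpow_natCast]; push_cast; ring
    rw [this]
    exact Real.rpow_le_rpow_of_exponent_le hN1 (by norm_num; linarith)
  have hNpow0 : 0 ≤ (N : ℝ) ^ (6 + ε₀) := by positivity
  -- pass to natural numbers
  have hrel' := natAbs_rel hrel
  set m := x.natAbs with hm
  set n := y.natAbs with hn
  set d := D.natAbs with hd
  have hd0 : d ≠ 0 := Int.natAbs_ne_zero.mpr hD
  have H1' : ∀ p : ℕ, p.Prime → p ∣ d → p ∣ N := fun p hp h ↦ H1 p hp (Int.natCast_dvd.mpr h)
  have H2' : ∀ p : ℕ, p.Prime → 5 ≤ p → p ∣ d → p ∣ m → p ^ 2 ∣ N :=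
    fun p hp h5 h h' ↦ H2 p hp h5 (Int.natCast_dvd.mpr h) (Int.natCast_dvd.mpr h')
  have hpow : ∀ (p k : ℕ) (z : ℤ), (p : ℤ) ^ k ∣ z ↔ p ^ k ∣ z.natAbs := fun p k z ↦ by
    rw [← Int.natCast_dvd]; push_cast; rfl
  have H3' : ∀ p : ℕ, p.Prime → 5 ≤ p → p ^ 4 ∣ m → ¬ p ^ 6 ∣ n := fun p hp h5 h h' ↦
    H3 p hp h5 ((hpow p 4 x).mpr h) ((hpow p 6 y).mpr h')
  have H4' : 2 ^ 8 ∣ m → ¬ 2 ^ 11 ∣ n := fun h h' ↦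
    H4 ((hpow 2 8 x).mpr h) ((hpow 2 11 y).mpr h')
  have H5' : 3 ^ 5 ∣ m → ¬ 3 ^ 9 ∣ n := fun h h' ↦
    H5 ((hpow 3 5 x).mpr h) ((hpow 3 9 y).mpr h')
  -- three cases
  rcases eq_or_ne m 0 with hm0 | hm0
  · -- `c₄ = 0`
    have hrel0 : n ^ 2 = 1728 * d := by
      rw [hm0] at hrel'
      rcases hrel' with h | h | h <;> omega
    have h := core_m_zero hd0 hN hrel0 (fun p hp h5 hpd ↦ H2' p hp h5 hpd (hm0 ▸ dvd_zero p))
      (fun p hp h5 ↦ H3' p hp h5 (hm0 ▸ dvd_zero _)) (H4' (hm0 ▸ dvd_zero _))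
      (H5' (hm0 ▸ dvd_zero _))
    have h' : (d : ℝ) ≤ 2 ^ 20 * 3 ^ 16 * ((N ^ 5 : ℕ) : ℝ) := by exact_mod_cast h
    calc (d : ℝ) ≤ 2 ^ 20 * 3 ^ 16 * ((N ^ 5 : ℕ) : ℝ) := h'
      _ ≤ 2 ^ 21 * 3 ^ 16 * (N : ℝ) ^ (6 + ε₀) := by nlinarith
      _ ≤ (A + 2 ^ 21 * 3 ^ 16) * (N : ℝ) ^ (6 + ε₀) := by nlinarith
  rcases eq_or_ne n 0 with hn0 | hn0
  · -- `c₆ = 0`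
    have hrel0 : m ^ 3 = 1728 * d := by
      rw [hn0] at hrel'
      rcases hrel' with h | h | h <;> omega
    have h := core_n_zero hd0 hN hrel0 H2'
      (fun p hp h5 h4 ↦ H3' p hp h5 h4 (hn0 ▸ dvd_zero _)) (fun h ↦ H4' h (hn0 ▸ dvd_zero _))
      (fun h ↦ H5' h (hn0 ▸ dvd_zero _))
    have h' : (d : ℝ) ≤ 2 ^ 21 * 3 ^ 12 * ((N ^ 5 : ℕ) : ℝ) := by exact_mod_cast h
    calc (d : ℝ) ≤ 2 ^ 21 * 3 ^ 12 * ((N ^ 5 : ℕ) : ℝ) := h'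
      _ ≤ 2 ^ 21 * 3 ^ 16 * (N : ℝ) ^ (6 + ε₀) := by nlinarith
      _ ≤ (A + 2 ^ 21 * 3 ^ 16) * (N : ℝ) ^ (6 + ε₀) := by nlinarith
  · -- main case
    have h := core_main hε hε' hK hm0 hn0 hd0 hN hrel' H1' H2' H3' H4' H5'
    calc (d : ℝ) ≤ A * (N : ℝ) ^ (6 * (1 + ε) / (1 - 5 * ε)) := h
      _ ≤ A * (N : ℝ) ^ (6 + ε₀) := mul_le_mul_of_nonneg_left hNpow1 hApos.le
      _ ≤ (A + 2 ^ 21 * 3 ^ 16) * (N : ℝ) ^ (6 + ε₀) := by nlinarith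

end Literature.NumberTheory.EllipticCurves.SzpiroOfAbc
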